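import Mathlib.LinearAlgebra.Matrix.SchurComplement
import Mathlib.GroupTheory.Perm.Fin
import Mathlib.Tactic.FinCases
import Literature.Computability.AlgebraicComplexity.BinaryDeterminantalComplexity
import Literature.Computability.AlgebraicComplexity.AlperBogartVelascoProofs
import Literature.Computability.AlgebraicComplexity.GrenetBinary
import Literature.LinearAlgebra.Matrix.PermanentSubperm
import HarnessLib

/-!
# Hüttenhain–Ikenmeyer 2016, Thm. 3 (`bdc(per₃) = 7`) — proof of the named fact
`huttenhainIkenmeyer2016_thm3`

Topic `Literature/Computability/AlgebraicComplexity`; sibling proofs file of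
`BinaryDeterminantalComplexity.lean`, which vendors J. Hüttenhain, C. Ikenmeyer, *Binary
determinantal complexity*, Linear Algebra Appl. 504 (2016) 559–573 (arXiv:1410.8202), **Theorem 3**:
"`bdc(per₃) = 7`", rendered as: no binary variable matrix (entries `0`, `1` or a variable) of size
`n < 7` over `ℤ` has determinant `per₃`, and one of size `7` does. This file DISCHARGES it
(`huttenhainIkenmeyer2016_thm3_holds`) WITHOUT the paper's computer enumeration:

* **lower bound.** A binary variable matrix has affine entries, so after the base change `ℤ → ℚ`
  (`MvPolynomial.map (Int.castRingHom ℚ)`, which sends `per₃` over `ℤ` to `per₃` over `ℚ`,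
  `map_perPoly`) a binary representation of size `n` is an affine determinantal representation of
  `per₃` over `ℚ` of size `n`, whence `n ≥ dc_ℚ(per₃) ≥ 7` by Alper–Bogart–Velasco 2017, Cor. 1.4
  (PROVED in the tree: `AlperBogartVelasco.seven_le_determinantalComplexity_perPoly_three`, any
  field with `2 ≠ 0`). (The paper, written before ABV, had only the `≥ 5` bound of
  Mignon–Ressayre available and closed the gap `5, 6` by enumerating bipartite graphs, §3.)
* **upper bound.** Grenet's `7 × 7` matrix `hiGrenet7` (display (grenet7x7) of the paper,
  transcribed in `BinaryDeterminantalComplexity.lean`) has `det hiGrenet7 = per₃`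
  (`det_hiGrenet7`): rotating the rows by the `7`-cycle `finRotate 7` (an even permutation) puts
  the six constants `1` on the diagonal; the rotated matrix is the block matrix
  `[[1₃, B], [C, D]]`, so its determinant is `det (D - C B)`
  (`Matrix.det_fromBlocks_one₁₁`), an explicit `4 × 4` determinant equal to
  `x₀₀(x₂₁x₁₂ + x₂₂x₁₁) + x₀₁(x₂₀x₁₂ + x₂₂x₁₀) + x₀₂(x₂₀x₁₁ + x₂₁x₁₀) = per₃`.

## References

* J. Hüttenhain, C. Ikenmeyer, *Binary determinantal complexity*, Linear Algebra Appl. 504 (2016)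
  559–573, arXiv:1410.8202 — Thm. 3, §4 display (grenet7x7). [HuttenhainIkenmeyer2016]
* J. Alper, T. Bogart, M. Velasco, *A lower bound for the determinantal complexity of a
  hypersurface*, Found. Comput. Math. 17 (2017) 829–836 — Cor. 1.4. [AlperBogartVelasco2017]
* B. Grenet, *An upper bound for the permanent versus determinant problem* (2011). [Grenet2011]
-/

noncomputable section

open Matrix MvPolynomial

namespace Literature.Computability.AlgebraicComplexity

namespace HuttenhainIkenmeyer

/-- **`det hiGrenet7 = per₃`**: Grenet's `7 × 7` binary variable matrix (Hüttenhain–Ikenmeyer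
2016, §4, display (grenet7x7)) has determinant the `3 × 3` permanent `∑_π ∏_i x_{π i, i}`.
Proof: rotating the rows by the even `7`-cycle `finRotate 7` and splitting `Fin 7 = Fin 3 ⊕ Fin 4`
gives a block matrix `[[1, B], [C, D]]` with determinant `det (D - C B)`
(`Matrix.det_fromBlocks_one₁₁`); the `4 × 4` Schur complement is computed entrywise and its
determinant expanded. [cite: HuttenhainIkenmeyer2016, Thm. 2 and §4 (grenet7x7)] -/
theorem det_hiGrenet7 : hiGrenet7.det = perPoly (Fin 3) ℤ := by
  have hrot : (hiGrenet7.submatrix (finRotate 7) id).det = hiGrenet7.det := by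
    rw [Matrix.det_permute, sign_finRotate]
    norm_num
  -- the rotated matrix in block form `[[1, B], [C, D]]`
  have hblk : Matrix.reindex finSumFinEquiv.symm finSumFinEquiv.symm
        (hiGrenet7.submatrix (finRotate 7) id) =
      Matrix.fromBlocks (1 : Matrix (Fin 3) (Fin 3) (MvPolynomial (Fin 3 × Fin 3) ℤ))
        !![X (2,1), X (2,2), 0, 0;
           X (2,0), 0, X (2,2), 0;
           0, X (2,0), X (2,1), 0]
        !![0, 0, 0;
           0, 0, 0;
           0, 0, 0;
           X (0,0), X (0,1), X (0,2)]
        !![1, 0, 0, X (1,2);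
           0, 1, 0, X (1,1);
           0, 0, 1, X (1,0);
           0, 0, 0, 0] := by
    refine Matrix.ext ?_
    rintro (i | i) (j | j) <;> fin_cases i <;> fin_cases j <;> rfl
  -- the Schur complement `D - C * B`, entrywise
  have hschur :
      (!![1, 0, 0, X (1,2);
          0, 1, 0, X (1,1);
          0, 0, 1, X (1,0);
          0, 0, 0, 0] : Matrix (Fin 4) (Fin 4) (MvPolynomial (Fin 3 × Fin 3) ℤ)) -
        (!![0, 0, 0;
            0, 0, 0;
            0, 0, 0;
            X (0,0), X (0,1), X (0,2)] : Matrix (Fin 4) (Fin 3) (MvPolynomial (Fin 3 × Fin 3) ℤ)) *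
        (!![X (2,1), X (2,2), 0, 0;
            X (2,0), 0, X (2,2), 0;
            0, X (2,0), X (2,1), 0] : Matrix (Fin 3) (Fin 4) (MvPolynomial (Fin 3 × Fin 3) ℤ)) =
      !![1, 0, 0, X (1,2);
         0, 1, 0, X (1,1);
         0, 0, 1, X (1,0);
         -(X (0,0) * X (2,1) + X (0,1) * X (2,0)), -(X (0,0) * X (2,2) + X (0,2) * X (2,0)),
           -(X (0,1) * X (2,2) + X (0,2) * X (2,1)), 0] := by
    ext i j
    fin_cases i <;> fin_cases j <;> simp
  replace hblk := congrArg Matrix.det hblk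
  rw [Matrix.det_reindex_self, Matrix.det_fromBlocks_one₁₁, hschur] at hblk
  rw [← hrot, hblk, perPoly, Matrix.permanent_fin_three_row]
  simp [Matrix.det_succ_row_zero, Fin.sum_univ_succ, Matrix.mvPolynomialX_apply,
    Fin.succAbove, Matrix.submatrix_apply]
  ring

/-- A binary variable matrix over `ℤ`, base-changed to `ℚ`, is a matrix of affine linear forms
(total degree `≤ 1`). [cite: HuttenhainIkenmeyer2016, §1] -/
theorem totalDegree_map_le_one_of_isBinaryVariableMatrix {σ : Type*} {m : Type*}
    {A : Matrix m m (MvPolynomial σ ℤ)} (hA : IsBinaryVariableMatrix A) (i j : m) :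
    (MvPolynomial.map (Int.castRingHom ℚ) (A i j)).totalDegree ≤ 1 := by
  rcases hA i j with h | h | ⟨v, h⟩ <;> rw [h]
  · simp
  · simp
  · rw [MvPolynomial.map_X]
    exact (totalDegree_X (R := ℚ) v).le

/-- **Lower bound of Thm. 3 without enumeration**: a binary variable matrix of size `n` with
determinant `per₃` gives, over `ℚ`, an affine determinantal representation of `per₃` of size `n`,
so `7 ≤ dc_ℚ(per₃) ≤ n` by Alper–Bogart–Velasco 2017, Cor. 1.4
(`AlperBogartVelasco.seven_le_determinantalComplexity_perPoly_three`).
[cite: AlperBogartVelasco2017, Cor. 1.4] -/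
theorem seven_le_of_isBinaryVariableMatrix_det_eq_perPoly {n : ℕ}
    {A : Matrix (Fin n) (Fin n) (MvPolynomial (Fin 3 × Fin 3) ℤ)} (hA : IsBinaryVariableMatrix A)
    (hdet : A.det = perPoly (Fin 3) ℤ) : 7 ≤ n := by
  have hrepr : HasDetRepr (perPoly (Fin 3) ℚ) n := by
    refine ⟨(MvPolynomial.map (Int.castRingHom ℚ)).mapMatrix A, fun i j => ?_, ?_⟩
    · exact totalDegree_map_le_one_of_isBinaryVariableMatrix hA i j
    · rw [← RingHom.map_det, hdet, map_perPoly]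
  exact (AlperBogartVelasco.seven_le_determinantalComplexity_perPoly_three ℚ (by norm_num)).trans
    (determinantalComplexity_le_of_hasDetRepr hrepr)

end HuttenhainIkenmeyer

/-- **Hüttenhain–Ikenmeyer 2016, Theorem 3 — PROVED** ("`bdc(per₃) = 7`"): no binary variable
matrix of size `n < 7` over `ℤ` has determinant `per₃` — by base change to `ℚ` and
Alper–Bogart–Velasco's `dc(per₃) ≥ 7` (Cor. 1.4, proved in the tree), replacing the paper's
computer enumeration of §3 — and Grenet's `7 × 7` binary variable matrix `hiGrenet7` has
determinant `per₃` (`HuttenhainIkenmeyer.det_hiGrenet7`). Discharges the named fact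
`huttenhainIkenmeyer2016_thm3` of `BinaryDeterminantalComplexity.lean`.
[cite: HuttenhainIkenmeyer2016, Thm. 3] -/
theorem huttenhainIkenmeyer2016_thm3_holds : huttenhainIkenmeyer2016_thm3 := by
  refine ⟨fun n hn A hA hdet => ?_, ⟨hiGrenet7, isBinaryVariableMatrix_hiGrenet7,
    HuttenhainIkenmeyer.det_hiGrenet7⟩⟩
  have h7 := HuttenhainIkenmeyer.seven_le_of_isBinaryVariableMatrix_det_eq_perPoly hA hdet
  omega

/-! ### Appendix (val-lit-p8): `dc_K ≤ bdc` over every commutative ring, and Grenet's bound by base change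

The lower-bound argument above uses the base change `ℤ → ℚ`. The same base change works along
`ℤ → K` for every commutative ring `K` (HI16 §1: "`dc(f) ≤ bdc(f)`"), which is the form other files
cite (`GrenetBinary.lean`'s binary Grenet matrix then gives `dc_K(per_n) ≤ 2ⁿ - 1` for every `K` and
every `n`, while the tree's `determinantalComplexity_perPoly_le_holds` is stated for fields and
`n ≥ 1`). -/

namespace HuttenhainIkenmeyer

/-- Base change of a binary variable matrix along `ℤ → K` (`K` any commutative ring): the mapped
matrix is an affine determinantal representation (entries of total degree `≤ 1`: `0`, `1`, `X v`)
of the base change of `det A` (HI16 §1, "`dc(f) ≤ bdc(f)`"). [cite: HuttenhainIkenmeyer2016, §1] -/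
theorem isAffineDetRepr_map {σ : Type*} {m : Type*} [Fintype m] [DecidableEq m]
    (K : Type*) [CommRing K] {A : Matrix m m (MvPolynomial σ ℤ)} (hA : IsBinaryVariableMatrix A) :
    IsAffineDetRepr (MvPolynomial.map (Int.castRingHom K) A.det)
      (A.map (MvPolynomial.map (Int.castRingHom K))) := by
  refine ⟨fun i j => ?_, ?_⟩
  · rw [Matrix.map_apply]
    rcases hA i j with h | h | ⟨v, h⟩ <;> rw [h]
    · rw [map_zero, totalDegree_zero]; exact zero_le_one
    · rw [map_one, totalDegree_one]; exact zero_le_one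
    · rw [MvPolynomial.map_X]
      simpa [X, Finsupp.sum_single_index] using
        totalDegree_monomial_le (R := K) (Finsupp.single v 1) 1
  · rw [RingHom.map_det, RingHom.mapMatrix_apply]

/-- A binary variable matrix of size `n` over `ℤ` with determinant `f` yields, over any commutative
ring `K`, an affine determinantal representation of size `n` of the base change of `f`; hence
`dc_K(f ⊗ K) ≤ n` (HI16 §1: "`dc(f) ≤ bdc(f)`"). [cite: HuttenhainIkenmeyer2016, §1] -/
theorem hasDetRepr_map {σ : Type*} {n : ℕ} (K : Type*) [CommRing K]
    {A : Matrix (Fin n) (Fin n) (MvPolynomial σ ℤ)} (hA : IsBinaryVariableMatrix A) :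
    HasDetRepr (MvPolynomial.map (Int.castRingHom K) A.det) n :=
  ⟨_, isAffineDetRepr_map K hA⟩

/-- `dc_K(f ⊗ K) ≤ bdc(f)` entrywise: the determinantal complexity over `K` of the base change of
the determinant of a binary variable matrix of size `n` is at most `n` (HI16 §1).
[cite: HuttenhainIkenmeyer2016, §1] -/
theorem determinantalComplexity_map_det_le {σ : Type*} {n : ℕ} (K : Type*) [CommRing K]
    {A : Matrix (Fin n) (Fin n) (MvPolynomial σ ℤ)} (hA : IsBinaryVariableMatrix A) :
    determinantalComplexity (MvPolynomial.map (Int.castRingHom K) A.det) ≤ n :=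
  determinantalComplexity_le_of_hasDetRepr (hasDetRepr_map K hA)

/-- **`dc_K(per_m) ≤ bdc(per_m)`**: if some binary variable matrix of size `n` over `ℤ` has
determinant `per_m`, then the determinantal complexity of the generic `m × m` permanent over any
commutative ring `K` is at most `n` (HI16 §1, with `map_perPoly`).
[cite: HuttenhainIkenmeyer2016, §1] -/
theorem determinantalComplexity_perPoly_le_of_isBinaryVariableMatrix {m n : ℕ} (K : Type*)
    [CommRing K] {A : Matrix (Fin n) (Fin n) (MvPolynomial (Fin m × Fin m) ℤ)}
    (hA : IsBinaryVariableMatrix A) (hdet : A.det = perPoly (Fin m) ℤ) :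
    determinantalComplexity (perPoly (Fin m) K) ≤ n := by
  have h := hasDetRepr_map K hA
  rw [hdet, map_perPoly] at h
  exact determinantalComplexity_le_of_hasDetRepr h

/-- **Grenet's bound over every commutative ring**: `dc_K(per_n) ≤ 2ⁿ - 1` for every commutative
ring `K` (nontrivial or not) and every `n`, by base change `ℤ → K` of the binary Grenet matrix of
HI16 Thm. 2 (`exists_isBinaryVariableMatrix_det_eq_perPoly`, `GrenetBinary.lean`); compare the
tree's `determinantalComplexity_perPoly_le_holds` (fields, `n ≥ 1`) and
`Grenet.exists_binary_det_eq_perPoly` (nontrivial rings). [cite: HuttenhainIkenmeyer2016, Thm. 2] -/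
theorem determinantalComplexity_perPoly_le_two_pow_sub_one (K : Type*) [CommRing K] (n : ℕ) :
    determinantalComplexity (perPoly (Fin n) K) ≤ 2 ^ n - 1 := by
  obtain ⟨A, hA, hdet⟩ := exists_isBinaryVariableMatrix_det_eq_perPoly n
  exact determinantalComplexity_perPoly_le_of_isBinaryVariableMatrix K hA hdet

end HuttenhainIkenmeyer

end Literature.Computability.AlgebraicComplexity

end
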